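import Summits.Ventures.HodgeRepro2.T5SU11ImproperHardyClass

/-!
# The `H¹` bound of the resolvent on the class

For `λ > 1` and a source `g` of the exponentially decaying class at a rate `ε > 1`, with `u = G^I_λ g`, `κ = (λ − 1)²`
and `μ = λ(λ − 2)`:

* `abs_inner_greenSolI_le`: `|⟨g, u⟩| ≤ ‖g‖²/(2κ′) + κ′ ‖u‖²/2` for every `κ′ > 0` (the pointwise
  `|g u| ≤ g²/(2κ′) + κ′ u²/2` integrated);
* `abs_inner_greenSolI_le'`: **`|⟨g, G^I_λ g⟩| ≤ ‖g‖²/(λ − 1)²`** (with `κ′ = κ` and row 532's `‖u‖² ≤ ‖g‖²/κ²`);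
* `integral_sinh_mul_greenSolI'_sq_le`: **`‖(G^I_λ g)′‖² ≤ ‖g‖²/(λ − 1)² + max(0, −μ) ‖g‖²/(λ − 1)⁴`** — from the energy
  identity `‖u′‖² = −⟨g, u⟩ − μ ‖u‖²` of row 531; for `λ ≥ 2` simply `‖(G^I_λ g)′‖² ≤ ‖g‖²/(λ − 1)²`
  (`integral_sinh_mul_greenSolI'_sq_le_of_two_le`).

Together with row 532 the resolvent is bounded from `L²(sinh 2t dt)` into `H¹(sinh 2t dt)` on the class, with explicit
constants. Nothing is claimed about (N).

Blind lane: Mathlib + the HodgeRepro2 prefix only; no sorry; axioms ⊆ {propext, Classical.choice,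
Quot.sound}.
-/

namespace Summit.Ventures.HodgeRepro2.T5SU11ImproperH1Bound

open Filter Topology MeasureTheory
open Set (Ioi Ioc)
open T5SU11Cartan T5SU11SphericalFunction T5SU11SphericalDecay T5SU11RadialGreenImproper
  T5SU11ImproperEnergyBracketAll T5SU11ImproperEnergyIdentityAll T5SU11ImproperHardyClass

section measure

variable [MeasurableSpace Circle] [BorelSpace Circle]

variable {lam : ℝ} (hlam : 1 < lam) {g : ℝ → ℝ} (hg : ContinuousOn g (Ioi 0))
  {M : ℝ} (hM : ∀ s ∈ Ioc (0 : ℝ) 1, |g s| ≤ M) (hM0 : 0 ≤ M)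
  {ε C s₀ : ℝ} (hε : 2 - lam < ε) (hC : ∀ s, s₀ ≤ s → |g s| ≤ C * Real.exp (-ε * s))
  (hε1 : 1 < ε)

include hlam hg hM hM0 hε hC hε1 in
/-- **`|⟨g, G^I_λ g⟩| ≤ ‖g‖²/(2κ′) + κ′ ‖G^I_λ g‖²/2`** for every `κ′ > 0`. -/
theorem abs_inner_greenSolI_le {κ' : ℝ} (hκ' : 0 < κ') :
    |∫ t in Ioi 0, Real.sinh (2 * t) * (g t * greenSolI (fun t => sph lam (hyp t)) (sphDecay lam) g t)|
      ≤ (∫ t in Ioi 0, Real.sinh (2 * t) * g t ^ 2) / (2 * κ')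
        + κ' / 2 * ∫ t in Ioi 0, Real.sinh (2 * t) * greenSolI (fun t => sph lam (hyp t)) (sphDecay lam) g t ^ 2 := by
  set u := greenSolI (fun t => sph lam (hyp t)) (sphDecay lam) g with hu
  have hI2 := integrableOn_sinh_mul_greenSolI_sq hlam hg hM hM0 hε hC hε1
  have hI3 := integrableOn_sinh_mul_mul_greenSolI hlam hg hM hM0 hε hC hε1
  have hIg := T5SU11ImproperL2Bound.integrableOn_sinh_mul_sq hg hM hC hε1
  have hIdom : IntegrableOn (fun t => Real.sinh (2 * t) * g t ^ 2 / (2 * κ') + κ' / 2 * (Real.sinh (2 * t) * u t ^ 2))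
      (Ioi 0) := (hIg.div_const _).add (hI2.const_mul _)
  calc |∫ t in Ioi 0, Real.sinh (2 * t) * (g t * u t)|
      ≤ ∫ t in Ioi 0, |Real.sinh (2 * t) * (g t * u t)| := by
        have := norm_integral_le_integral_norm (μ := volume.restrict (Ioi 0))
          (fun t => Real.sinh (2 * t) * (g t * u t))
        simpa only [Real.norm_eq_abs] using this
    _ ≤ ∫ t in Ioi 0, (Real.sinh (2 * t) * g t ^ 2 / (2 * κ') + κ' / 2 * (Real.sinh (2 * t) * u t ^ 2)) := by
        apply setIntegral_mono_on hI3.abs hIdom measurableSet_Ioi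
        intro t ht
        have ht0 : 0 < t := ht
        have hsinh : 0 ≤ Real.sinh (2 * t) := Real.sinh_nonneg_iff.mpr (by linarith)
        rw [abs_mul, abs_of_nonneg hsinh, abs_mul]
        have hamgm : |g t| * |u t| ≤ g t ^ 2 / (2 * κ') + κ' / 2 * u t ^ 2 := by
          have hsq := sq_nonneg (|g t| - κ' * |u t|)
          have e1 : |g t| ^ 2 = g t ^ 2 := sq_abs _
          have e2 : |u t| ^ 2 = u t ^ 2 := sq_abs _
          have h2' : 2 * κ' * (|g t| * |u t|) ≤ g t ^ 2 + κ' ^ 2 * u t ^ 2 := by nlinarith [hsq, e1, e2]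
          rw [show g t ^ 2 / (2 * κ') + κ' / 2 * u t ^ 2 = (g t ^ 2 + κ' ^ 2 * u t ^ 2) / (2 * κ') by field_simp]
          rw [le_div_iff₀ (by positivity)]
          linarith
        calc Real.sinh (2 * t) * (|g t| * |u t|)
            ≤ Real.sinh (2 * t) * (g t ^ 2 / (2 * κ') + κ' / 2 * u t ^ 2) := mul_le_mul_of_nonneg_left hamgm hsinh
          _ = Real.sinh (2 * t) * g t ^ 2 / (2 * κ') + κ' / 2 * (Real.sinh (2 * t) * u t ^ 2) := by ring
    _ = (∫ t in Ioi 0, Real.sinh (2 * t) * g t ^ 2) / (2 * κ')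
        + κ' / 2 * ∫ t in Ioi 0, Real.sinh (2 * t) * u t ^ 2 := by
        rw [integral_add (hIg.div_const _) (hI2.const_mul _), MeasureTheory.integral_div,
          MeasureTheory.integral_const_mul]

include hlam hg hM hM0 hε hC hε1 in
/-- **`|⟨g, G^I_λ g⟩| ≤ ‖g‖²/(λ − 1)²`** on the class, every `λ > 1`. -/
theorem abs_inner_greenSolI_le' :
    |∫ t in Ioi 0, Real.sinh (2 * t) * (g t * greenSolI (fun t => sph lam (hyp t)) (sphDecay lam) g t)|
      ≤ (∫ t in Ioi 0, Real.sinh (2 * t) * g t ^ 2) / (lam - 1) ^ 2 := by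
  set κ := (lam - 1) ^ 2 with hκ
  have hκ0 : 0 < κ := by rw [hκ]; positivity
  have h1 := abs_inner_greenSolI_le hlam hg hM hM0 hε hC hε1 hκ0
  have h2 := integral_sinh_mul_greenSolI_sq_le_all hlam hg hM hM0 hε hC hε1
  rw [← hκ] at h2
  set G := ∫ t in Ioi 0, Real.sinh (2 * t) * g t ^ 2 with hG
  set B := ∫ t in Ioi 0, Real.sinh (2 * t) * greenSolI (fun t => sph lam (hyp t)) (sphDecay lam) g t ^ 2 with hB
  have h3 : κ / 2 * B ≤ κ / 2 * (G / κ ^ 2) := mul_le_mul_of_nonneg_left h2 (by positivity)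
  have e : G / (2 * κ) + κ / 2 * (G / κ ^ 2) = G / κ := by field_simp; ring
  linarith

include hlam hg hM hM0 hε hC hε1 in
/-- **THE `H¹` BOUND OF THE RESOLVENT ON THE CLASS**:
`‖(G^I_λ g)′‖² ≤ ‖g‖²/(λ − 1)² + max(0, −λ(λ − 2)) ‖g‖²/(λ − 1)⁴`, every `λ > 1`, source rate `ε > 1`. -/
theorem integral_sinh_mul_greenSolI'_sq_le :
    ∫ t in Ioi 0, Real.sinh (2 * t) * greenSolI' (deriv fun t => sph lam (hyp t)) (sphDecay' lam)
        (fun t => sph lam (hyp t)) (sphDecay lam) g t ^ 2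
      ≤ (∫ t in Ioi 0, Real.sinh (2 * t) * g t ^ 2) / (lam - 1) ^ 2
        + max 0 (-(lam * (lam - 2))) * ((∫ t in Ioi 0, Real.sinh (2 * t) * g t ^ 2) / ((lam - 1) ^ 2) ^ 2) := by
  have hE := energy_identity_class hlam hg hM hM0 hε hC hε1
  have h1 := abs_inner_greenSolI_le' hlam hg hM hM0 hε hC hε1
  have h2 := integral_sinh_mul_greenSolI_sq_le_all hlam hg hM hM0 hε hC hε1
  set G := ∫ t in Ioi 0, Real.sinh (2 * t) * g t ^ 2 with hG
  set B := ∫ t in Ioi 0, Real.sinh (2 * t) * greenSolI (fun t => sph lam (hyp t)) (sphDecay lam) g t ^ 2 with hB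
  set P := ∫ t in Ioi 0, Real.sinh (2 * t) * (g t * greenSolI (fun t => sph lam (hyp t)) (sphDecay lam) g t) with hP
  have hB0 : 0 ≤ B := by
    apply setIntegral_nonneg measurableSet_Ioi
    intro t ht
    have ht0 : 0 < t := ht
    exact mul_nonneg (Real.sinh_nonneg_iff.mpr (by linarith)) (sq_nonneg _)
  have hP' : -P ≤ G / (lam - 1) ^ 2 := le_trans (neg_le_abs P) h1
  have hmax : -(lam * (lam - 2)) * B ≤ max 0 (-(lam * (lam - 2))) * B :=
    mul_le_mul_of_nonneg_right (le_max_right _ _) hB0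
  have hmax' : max 0 (-(lam * (lam - 2))) * B ≤ max 0 (-(lam * (lam - 2))) * (G / ((lam - 1) ^ 2) ^ 2) :=
    mul_le_mul_of_nonneg_left h2 (le_max_left _ _)
  linarith

include hlam hg hM hM0 hε hC hε1 in
/-- **`‖(G^I_λ g)′‖² ≤ ‖g‖²/(λ − 1)²` for `λ ≥ 2`** (`μ ≥ 0`). -/
theorem integral_sinh_mul_greenSolI'_sq_le_of_two_le (h2 : 2 ≤ lam) :
    ∫ t in Ioi 0, Real.sinh (2 * t) * greenSolI' (deriv fun t => sph lam (hyp t)) (sphDecay' lam)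
        (fun t => sph lam (hyp t)) (sphDecay lam) g t ^ 2
      ≤ (∫ t in Ioi 0, Real.sinh (2 * t) * g t ^ 2) / (lam - 1) ^ 2 := by
  have h := integral_sinh_mul_greenSolI'_sq_le hlam hg hM hM0 hε hC hε1
  have hμ : 0 ≤ lam * (lam - 2) := mul_nonneg (by linarith) (by linarith)
  have hmax : max 0 (-(lam * (lam - 2))) = 0 := max_eq_left (by linarith)
  rw [hmax, zero_mul, add_zero] at h
  exact h

end measure

end Summit.Ventures.HodgeRepro2.T5SU11ImproperH1Bound
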